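import Summits.CriticalPhenomena.PercolationContinuityZ3.Theorems.PercNearOneGluingNoHeavyLowerTailKnQuestion8CoefficientwiseCoreClassKernelMixIETFlow
import Summits.CriticalPhenomena.PercolationContinuityZ3.Theorems.PercNearOneGluingNoHeavyLowerTailKnQuestion8CoefficientwiseCoreClassSeriesMain
import HarnessLib

/-!
# Two fibrewise flows with joins, I: one fibrewise flow (the abstract landing lemma)

Support file (`--supports stmt-CriticalPhenomena-4575`, closed), prover `prim-cplus-coupling` (gen 42).  No definitions, no notations, no named facts,
no sorries; standard axioms.  Memo `prim-cplus-coupling/A5-COUPLING-gen42.md` §7.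

ABSTRACT SETTING.  A finite index set is split into three pairwise disjoint parts `P` (the thread carrying the h-levels), `Q` (the thread carrying the
k-levels) and `O` (all other edges); a colouring `ω ⊆ P ∪ Q ∪ O` has the words `ω ∩ P`, `ω ∩ Q`, `ω ∩ O`.  Predicates on words: `hro, hbo` (h red-only / blue-only
in the demand sense, functions of the `P`-word), `kro, kbo` (functions of the `Q`-word), with `hbo`, `kbo` ANTITONE; on `O`-words a 'no full thread' predicate
`noF`, a 'has an empty thread' predicate `hasE`, and an injective LIFT `lift` (empty threads ↦ full threads) with `η ⊆ lift η ⊆ O`.  The demand region is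
`D(a, γ, η) :⟺ a ≠ P ∧ γ ≠ Q ∧ noF η ∧ (a = ∅ ∨ γ = ∅ ∨ hasE η)`; `bad₁ = D ∧ hro ∧ kbo`, `bad₂ = D ∧ hbo ∧ kro`, the JOINS `P₁ = D ∧ hro ∧ kro`.
THEOREM (`Coefficientwise.fibre_flows_joins`, in the sequel file …KernelMixFibreFlowsJoins): for every up-closed event `𝒱`,
  `#(𝒱 ∩ bad₁) + #(𝒱 ∩ bad₂) ≤ #(𝒱 ∩ (T₁ ∪ T₂)) + #(𝒱 ∩ P₁)`,
where `T₁` (resp. `T₂`) is the explicit image of FLOW 1 = two-colouring Harris on the `Q`-word with the `P`- and `O`-words frozen, followed by the lift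
(resp. FLOW 2, Harris on the `P`-word).  The two images are hit injectively; they overlap only above joins, which pay the second unit.
On a bundle `Θ` with `hᵃ, hᵇ` supported on thread `p` and `kᵃ, kᵇ` on thread `q`, `T₁ ∪ T₂ ⊆ L₁ ∪ L₂ ⊆ S` (memo §7; the cluster-trace glue is not in this
file), so this is the counting core of THEOREM LP1(Θ) for thread-supported levels, and with `iet_graph_of_indicator_levels` of IET(Θ) for thread-additive levels.
-/

namespace Summit.CriticalPhenomena.PercolationContinuityZ3.Theorems

open Finset

namespace Coefficientwise

variable {ι : Type*}

open Classical in
/-- **One fibrewise flow (abstract).**  `P, Q, O` pairwise disjoint; `𝒱` up-closed; `kbo` antitone on `Q`-words; `D` as in the module docstring.  Then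
the number of `𝒱 ∩ bad₁` colourings (`bad₁ = D ∧ hro(P-word) ∧ kbo(Q-word)`) is at most the number of LANDING pairs `(ρ, γ′)`, `ρ ⊆ P ∪ O`, `γ′ ⊆ Q`, with
`γ′ ∪ ρ ∈ 𝒱`, `hro (ρ ∩ P)`, `kbo (Q ∖ γ′)` and `D(ρ ∩ P, Q ∖ γ′, ρ ∩ O)` — two-colouring Harris (`sum_mul_sdiff_le_sum_mul`) on the `Q`-word in every fibre `ρ`.
[cite: KozmaNitzan2024, Questions 8–9 (§5.5 p. 36) (context); Harris 1960] -/
theorem fibre_flow_landing [DecidableEq ι] (P Q O : Finset ι) (hPQ : Disjoint P Q) (hQO : Disjoint Q O)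
    (𝒱 : Finset ι → Prop) (hV : ∀ ⦃s t : Finset ι⦄, s ⊆ t → 𝒱 s → 𝒱 t)
    (hro kbo : Finset ι → Prop) (noF hasE : Finset ι → Prop)
    (kbo_anti : ∀ γ γ' : Finset ι, γ ⊆ γ' → γ' ⊆ Q → kbo γ' → kbo γ) :
    (∑ ω ∈ (Q ∪ (P ∪ O)).powerset,
        if 𝒱 ω ∧ ((ω ∩ P ≠ P ∧ ω ∩ Q ≠ Q ∧ noF (ω ∩ O) ∧ (ω ∩ P = ∅ ∨ ω ∩ Q = ∅ ∨ hasE (ω ∩ O))) ∧ hro (ω ∩ P) ∧ kbo (ω ∩ Q))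
        then (1 : ℝ) else 0)
      ≤ ∑ ρ ∈ (P ∪ O).powerset, ∑ γ ∈ Q.powerset,
        if 𝒱 (γ ∪ ρ) ∧ hro (ρ ∩ P) ∧ kbo (Q \ γ) ∧ (ρ ∩ P ≠ P ∧ Q \ γ ≠ Q ∧ noF (ρ ∩ O) ∧ (ρ ∩ P = ∅ ∨ Q \ γ = ∅ ∨ hasE (ρ ∩ O)))
        then (1 : ℝ) else 0 := by
  have hQPO : Disjoint Q (P ∪ O) := by
    rw [Finset.disjoint_union_right]; exact ⟨hPQ.symm, hQO⟩
  rw [sum_powerset_union_disjoint hQPO]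
  rw [Finset.sum_comm]
  apply Finset.sum_le_sum
  intro ρ hρ
  have hρPO : ρ ⊆ P ∪ O := Finset.mem_powerset.mp hρ
  -- words of γ ∪ ρ
  have wQ : ∀ γ ∈ Q.powerset, (γ ∪ ρ) ∩ Q = γ := by
    intro γ hγ
    have hγQ : γ ⊆ Q := Finset.mem_powerset.mp hγ
    ext x; constructor
    · intro hx
      rw [Finset.mem_inter, Finset.mem_union] at hx
      rcases hx.1 with h1 | h1
      · exact h1
      · exfalso; exact Finset.disjoint_left.mp hQPO hx.2 (hρPO h1)
    · intro hx; exact Finset.mem_inter.mpr ⟨Finset.mem_union_left _ hx, hγQ hx⟩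
  have wP : ∀ γ ∈ Q.powerset, (γ ∪ ρ) ∩ P = ρ ∩ P := by
    intro γ hγ
    have hγQ : γ ⊆ Q := Finset.mem_powerset.mp hγ
    ext x; constructor
    · intro hx
      rw [Finset.mem_inter, Finset.mem_union] at hx
      rcases hx.1 with h1 | h1
      · exfalso; exact Finset.disjoint_left.mp hPQ hx.2 (hγQ h1)
      · exact Finset.mem_inter.mpr ⟨h1, hx.2⟩
    · intro hx; rw [Finset.mem_inter] at hx; exact Finset.mem_inter.mpr ⟨Finset.mem_union_right _ hx.1, hx.2⟩
  have wO : ∀ γ ∈ Q.powerset, (γ ∪ ρ) ∩ O = ρ ∩ O := by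
    intro γ hγ
    have hγQ : γ ⊆ Q := Finset.mem_powerset.mp hγ
    ext x; constructor
    · intro hx
      rw [Finset.mem_inter, Finset.mem_union] at hx
      rcases hx.1 with h1 | h1
      · exfalso; exact Finset.disjoint_left.mp hQO (hγQ h1) hx.2
      · exact Finset.mem_inter.mpr ⟨h1, hx.2⟩
    · intro hx; rw [Finset.mem_inter] at hx; exact Finset.mem_inter.mpr ⟨Finset.mem_union_right _ hx.1, hx.2⟩
  -- the two monotone functions on the Q-cube
  set a := ρ ∩ P with ha
  set η := ρ ∩ O with hη
  set F : Finset ι → ℝ := fun γ => if 𝒱 (γ ∪ ρ) ∧ hro a then 1 else 0 with hF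
  set G : Finset ι → ℝ := fun γ => if kbo (Q \ γ) ∧ (a ≠ P ∧ Q \ γ ≠ Q ∧ noF η ∧ (a = ∅ ∨ Q \ γ = ∅ ∨ hasE η)) then 1 else 0 with hG
  have mF : Monotone F := by
    intro s t hst
    simp only [hF]
    by_cases h1 : 𝒱 (s ∪ ρ) ∧ hro a
    · rw [if_pos h1, if_pos ⟨hV (Finset.union_subset_union hst (le_refl ρ)) h1.1, h1.2⟩]
    · rw [if_neg h1]; split_ifs <;> norm_num
  have mG : Monotone G := by
    intro s t hst
    simp only [hG]
    have hts : Q \ t ⊆ Q \ s := Finset.sdiff_subset_sdiff (le_refl Q) hst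
    by_cases h1 : kbo (Q \ s) ∧ (a ≠ P ∧ Q \ s ≠ Q ∧ noF η ∧ (a = ∅ ∨ Q \ s = ∅ ∨ hasE η))
    · have h2 : kbo (Q \ t) ∧ (a ≠ P ∧ Q \ t ≠ Q ∧ noF η ∧ (a = ∅ ∨ Q \ t = ∅ ∨ hasE η)) := by
        refine ⟨kbo_anti _ _ hts Finset.sdiff_subset h1.1, h1.2.1, ?_, h1.2.2.2.1, ?_⟩
        · intro hQt; apply h1.2.2.1
          exact Finset.Subset.antisymm Finset.sdiff_subset (hQt.symm.le.trans hts)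
        · rcases h1.2.2.2.2 with h3 | h3 | h3
          · exact Or.inl h3
          · exact Or.inr (Or.inl (Finset.subset_empty.mp (h3 ▸ hts)))
          · exact Or.inr (Or.inr h3)
      rw [if_pos h1, if_pos h2]
    · rw [if_neg h1]; split_ifs <;> norm_num
  have key := sum_mul_sdiff_le_sum_mul Q F G mF mG
  -- identify the two sides
  have lhs : ∀ γ ∈ Q.powerset,
      (if 𝒱 (γ ∪ ρ) ∧ (((γ ∪ ρ) ∩ P ≠ P ∧ (γ ∪ ρ) ∩ Q ≠ Q ∧ noF ((γ ∪ ρ) ∩ O) ∧ ((γ ∪ ρ) ∩ P = ∅ ∨ (γ ∪ ρ) ∩ Q = ∅ ∨ hasE ((γ ∪ ρ) ∩ O)))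
          ∧ hro ((γ ∪ ρ) ∩ P) ∧ kbo ((γ ∪ ρ) ∩ Q)) then (1 : ℝ) else 0) = F γ * G (Q \ γ) := by
    intro γ hγ
    have hγQ : γ ⊆ Q := Finset.mem_powerset.mp hγ
    rw [wQ γ hγ, wP γ hγ, wO γ hγ]
    simp only [hF, hG]
    rw [Finset.sdiff_sdiff_eq_self hγQ]
    by_cases h1 : 𝒱 (γ ∪ ρ) ∧ hro a
    · rw [if_pos h1, one_mul]
      by_cases h2 : kbo γ ∧ (a ≠ P ∧ γ ≠ Q ∧ noF η ∧ (a = ∅ ∨ γ = ∅ ∨ hasE η))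
      · rw [if_pos h2, if_pos ⟨h1.1, h2.2, h1.2, h2.1⟩]
      · rw [if_neg h2, if_neg (fun h3 => h2 ⟨h3.2.2.2, h3.2.1⟩)]
    · rw [if_neg h1, zero_mul, if_neg (fun h3 => h1 ⟨h3.1, h3.2.2.1⟩)]
  have rhs : ∀ γ ∈ Q.powerset,
      (if 𝒱 (γ ∪ ρ) ∧ hro (ρ ∩ P) ∧ kbo (Q \ γ) ∧ (ρ ∩ P ≠ P ∧ Q \ γ ≠ Q ∧ noF (ρ ∩ O) ∧ (ρ ∩ P = ∅ ∨ Q \ γ = ∅ ∨ hasE (ρ ∩ O)))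
          then (1 : ℝ) else 0) = F γ * G γ := by
    intro γ _
    simp only [hF, hG]
    by_cases h1 : 𝒱 (γ ∪ ρ) ∧ hro a
    · rw [if_pos h1, one_mul]
      by_cases h2 : kbo (Q \ γ) ∧ (a ≠ P ∧ Q \ γ ≠ Q ∧ noF η ∧ (a = ∅ ∨ Q \ γ = ∅ ∨ hasE η))
      · rw [if_pos h2, if_pos ⟨h1.1, h1.2, h2.1, h2.2⟩]
      · rw [if_neg h2, if_neg (fun h3 => h2 ⟨h3.2.2.1, h3.2.2.2⟩)]
    · rw [if_neg h1, zero_mul, if_neg (fun h3 => h1 ⟨h3.1, h3.2.1⟩)]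
  rw [Finset.sum_congr rfl lhs, Finset.sum_congr rfl rhs]
  exact key

/-- Words of a three-part union: for `a ⊆ P`, `g ⊆ Q`, `L ⊆ O` with `P, Q, O` pairwise disjoint, `(a ∪ g ∪ L) ∩ P = a`, `∩ Q = g`, `∩ O = L`. [folklore] -/
theorem words_of_union3 [DecidableEq ι] {P Q O a g L : Finset ι} (hPQ : Disjoint P Q) (hPO : Disjoint P O) (hQO : Disjoint Q O)
    (ha : a ⊆ P) (hg : g ⊆ Q) (hL : L ⊆ O) :
    (a ∪ g ∪ L) ∩ P = a ∧ (a ∪ g ∪ L) ∩ Q = g ∧ (a ∪ g ∪ L) ∩ O = L := by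
  refine ⟨?_, ?_, ?_⟩
  · ext x; simp only [Finset.mem_inter, Finset.mem_union]; constructor
    · rintro ⟨(h1 | h1) | h1, h2⟩
      · exact h1
      · exact absurd h2 (Finset.disjoint_right.mp hPQ (hg h1))
      · exact absurd h2 (Finset.disjoint_right.mp hPO (hL h1))
    · intro h; exact ⟨Or.inl (Or.inl h), ha h⟩
  · ext x; simp only [Finset.mem_inter, Finset.mem_union]; constructor
    · rintro ⟨(h1 | h1) | h1, h2⟩
      · exact absurd h2 (Finset.disjoint_left.mp hPQ (ha h1))
      · exact h1
      · exact absurd h2 (Finset.disjoint_right.mp hQO (hL h1))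
    · intro h; exact ⟨Or.inl (Or.inr h), hg h⟩
  · ext x; simp only [Finset.mem_inter, Finset.mem_union]; constructor
    · rintro ⟨(h1 | h1) | h1, h2⟩
      · exact absurd h2 (Finset.disjoint_left.mp hPO (ha h1))
      · exact absurd h2 (Finset.disjoint_left.mp hQO (hg h1))
      · exact h1
    · intro h; exact ⟨Or.inr h, hL h⟩

end Coefficientwise

end Summit.CriticalPhenomena.PercolationContinuityZ3.Theorems
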